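import Summits.CriticalPhenomena.PercolationContinuityZ3.Theorems.PercNearOneGluingNoHeavyLowerTailSunflowerSafeFactor
import Mathlib.Data.Finset.Option
import HarnessLib
import HarnessLib.Audit

/-!
# `NoHeavyLowerTail` (crux stmt-CriticalPhenomena-4575), abstract sunflower cubic: VERTEX GLUING (1-sums) of two sunflowers — the construction and the
# link-type decomposition of its partition functional (infrastructure for pendant-block lemmas)

Support file (seat `prim-ineq-gen-2` gen 27; `--supports stmt-CriticalPhenomena-4575`; sequel of `…SunflowerSafeFactor` / `…SunflowerJoinClosed`).  No `sorry`,
nothing is asserted about the crux.  Memo: run/shared/lean/prim/prim-ineq-gen-2/SAFE-FACTOR-GEN27.md §4–5.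

SETTING.  `F : Sunflower (Option α)` and `G : Sunflower (Option β)` share the GLUE VERTEX `none`.  Their 1-SUM `F.glue G` is the sunflower on `Option (α ⊕ β)` with
  `lab S = lab_F (resL S) ∨ lab_G (resR S)`,  `resL S = {none | none ∈ S} ∪ {some a | some (inl a) ∈ S}` (and `resR` symmetrically)
(`Sunflower.lab_glue`): the union of two coloured hypergraphs meeting in exactly one point (a cut vertex).  After the θ-join (`…SunflowerJoinClosed`: ★ is closed under
disjoint union, gluing number `t = 0`) this is gluing number `t = 1`.

DECOMPOSITION (`Sunflower.ZH_glue_eq`).  An ordered 3-partition of `Option (α ⊕ β)` is (block `k₀` of the glue vertex, a block function on `α`, one on `β`):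
  `(F.glue G).ZH = Σ_{k₀} Σ_{g₁} Σ_{g₂} s6H (ℓ_F(k₀,g₁) ∨ ℓ_G(k₀,g₂))`,  `ℓ_F(k₀,g₁)_k = lab_F (fib (Option.elim · k₀ g₁) k)`,
i.e. the functional only sees, per side, the LINK-TYPE data (labels of the blocks with the glue vertex placed in block `k₀`).  STATUS OF THE t = 1 STEP (memo §4): for
every gadget `F` on ≤ 3 further points (and 400 random larger ones) an exact LP finds a certificate `★(G) ∧ ★(G − v) ⟹ ★(F.glue G)` over the 1 728 ordered link types of
`G` (kit j193253, 0 failures) — the PENDANT-BLOCK LEMMAS a successor can kernel-check on top of this file exactly like `certM` of `…SunflowerJoinClosed`; a universal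
(tensor) certificate for t = 1 does not exist with the known rows (kit j192614, j193195, j193388).
-/

namespace Summit.CriticalPhenomena.PercolationContinuityZ3.Theorems.SunflowerPartition

open Finset

section Glue

variable {α β : Type*} [Fintype α] [DecidableEq α] [Fintype β] [DecidableEq β]

/-- Restriction to the `F`-side: the glue vertex `none` and the `inl` points. [this work] -/
def resL (S : Finset (Option (α ⊕ β))) : Finset (Option α) :=
  ((S.eraseNone).toLeft.image some) ∪ (if none ∈ S then {none} else ∅)

/-- Restriction to the `G`-side: the glue vertex `none` and the `inr` points. [this work] -/
def resR (S : Finset (Option (α ⊕ β))) : Finset (Option β) :=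
  ((S.eraseNone).toRight.image some) ∪ (if none ∈ S then {none} else ∅)

omit [Fintype α] [Fintype β] in
/-- Membership in `resL`: `o ∈ resL S ↔ o.map inl ∈ S`. [this work] -/
theorem mem_resL (S : Finset (Option (α ⊕ β))) (o : Option α) : o ∈ resL S ↔ Option.map Sum.inl o ∈ S := by
  unfold resL
  cases o with
  | none =>
    by_cases h : none ∈ S
    · simp [h]
    · simp [h]
  | some a =>
    by_cases h : none ∈ S
    · simp [h]
    · simp [h]

omit [Fintype α] [Fintype β] in
/-- Membership in `resR`: `o ∈ resR S ↔ o.map inr ∈ S`. [this work] -/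
theorem mem_resR (S : Finset (Option (α ⊕ β))) (o : Option β) : o ∈ resR S ↔ Option.map Sum.inr o ∈ S := by
  unfold resR
  cases o with
  | none =>
    by_cases h : none ∈ S
    · simp [h]
    · simp [h]
  | some b =>
    by_cases h : none ∈ S
    · simp [h]
    · simp [h]

omit [Fintype α] [Fintype β] in
/-- `resL` is monotone. [this work] -/
theorem resL_mono {S T : Finset (Option (α ⊕ β))} (h : S ⊆ T) : resL S ⊆ resL T := by
  intro o ho
  rw [mem_resL] at ho ⊢
  exact h ho

omit [Fintype α] [Fintype β] in
/-- `resR` is monotone. [this work] -/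
theorem resR_mono {S T : Finset (Option (α ⊕ β))} (h : S ⊆ T) : resR S ⊆ resR T := by
  intro o ho
  rw [mem_resR] at ho ⊢
  exact h ho

/-- The three up-sets of the 1-sum: `S ↦ i ∈ colset (lab_F (resL S)) ∪ colset (lab_G (resR S))`. [this work] -/
def glueU (F : Sunflower (Option α)) (G : Sunflower (Option β)) (i : Fin 3) : Finset (Finset (Option (α ⊕ β))) :=
  univ.filter fun S => i ∈ colset (F.lab (resL S)) ∪ colset (G.lab (resR S))

/-- The up-sets of the 1-sum are up-sets. [this work] -/
theorem glueU_upper (F : Sunflower (Option α)) (G : Sunflower (Option β)) (i : Fin 3) :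
    IsUpperSet (glueU F G i : Set (Finset (Option (α ⊕ β)))) := by
  intro S T hST hS
  rw [Finset.mem_coe, glueU, mem_filter] at hS ⊢
  refine ⟨mem_univ _, ?_⟩
  have h1 := colset_mono _ _ (F.lab_mono (resL_mono hST))
  have h2 := colset_mono _ _ (G.lab_mono (resR_mono hST))
  rw [mem_union] at hS ⊢
  rcases hS.2 with h | h
  · exact Or.inl (h1 h)
  · exact Or.inr (h2 h)

/-- **The 1-sum (vertex gluing)** of two sunflowers sharing the glue vertex `none`: the sunflower on `Option (α ⊕ β)` with
`lab S = lab_F (resL S) ∨ lab_G (resR S)`. [this work] -/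
def Sunflower.glue (F : Sunflower (Option α)) (G : Sunflower (Option β)) : Sunflower (Option (α ⊕ β)) :=
  ofUpsets (glueU F G) (glueU_upper F G)

/-- **Labels of the 1-sum**. [this work] -/
theorem Sunflower.lab_glue (F : Sunflower (Option α)) (G : Sunflower (Option β)) (S : Finset (Option (α ⊕ β))) :
    (F.glue G).lab S = joinM (F.lab (resL S)) (G.lab (resR S)) := by
  rw [Sunflower.glue, lab_ofUpsets_eq_theta, ← theta_colset_union]
  congr 1
  ext i
  simp [glueU]

/-! ## The link-type decomposition of the partition functional of a 1-sum -/

/-- Reassembling a block function on `Option (α ⊕ β)` from the block of the glue vertex and the two side functions. [this work] -/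
def joinFun (p : Fin 3 × (α → Fin 3) × (β → Fin 3)) : Option (α ⊕ β) → Fin 3 :=
  fun o => o.elim p.1 (Sum.elim p.2.1 p.2.2)

/-- Splitting a block function on `Option (α ⊕ β)`. [this work] -/
def splitFun (g : Option (α ⊕ β) → Fin 3) : Fin 3 × (α → Fin 3) × (β → Fin 3) :=
  (g none, fun a => g (some (Sum.inl a)), fun b => g (some (Sum.inr b)))

/-- `splitFun` / `joinFun` as an equivalence. [this work] -/
def splitEquiv : (Option (α ⊕ β) → Fin 3) ≃ Fin 3 × (α → Fin 3) × (β → Fin 3) where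
  toFun := splitFun
  invFun := joinFun
  left_inv g := by
    funext o
    rcases o with _ | a | b <;> rfl
  right_inv p := by
    rcases p with ⟨k, g₁, g₂⟩
    rfl

/-- The `F`-side block function: the glue vertex in block `k₀`, the points of `α` by `g₁`. [this work] -/
def sideFun {γ : Type*} (k₀ : Fin 3) (g₁ : γ → Fin 3) : Option γ → Fin 3 := fun o => o.elim k₀ g₁

/-- The `F`-side restriction of a block of the reassembled function is the corresponding block of the side function. [this work] -/
theorem resL_fib_joinFun (k₀ : Fin 3) (g₁ : α → Fin 3) (g₂ : β → Fin 3) (k : Fin 3) :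
    resL (fib (joinFun (k₀, g₁, g₂)) k) = fib (sideFun k₀ g₁) k := by
  ext o
  rw [mem_resL, mem_fib, mem_fib]
  rcases o with _ | a <;> rfl

/-- The `G`-side restriction of a block of the reassembled function is the corresponding block of the side function. [this work] -/
theorem resR_fib_joinFun (k₀ : Fin 3) (g₁ : α → Fin 3) (g₂ : β → Fin 3) (k : Fin 3) :
    resR (fib (joinFun (k₀, g₁, g₂)) k) = fib (sideFun k₀ g₂) k := by
  ext o
  rw [mem_resR, mem_fib, mem_fib]
  rcases o with _ | b <;> rfl

/-- **Link-type decomposition of the 1-sum's partition functional**: sum over the block `k₀` of the glue vertex and the two side block functions; each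
side enters only through the labels of its blocks with the glue vertex placed in block `k₀`. [this work] -/
theorem Sunflower.ZH_glue_eq (F : Sunflower (Option α)) (G : Sunflower (Option β)) :
    (F.glue G).ZH = ∑ k₀ : Fin 3, ∑ g₁ : α → Fin 3, ∑ g₂ : β → Fin 3,
      s6H (joinM (F.lab (fib (sideFun k₀ g₁) 0)) (G.lab (fib (sideFun k₀ g₂) 0)))
          (joinM (F.lab (fib (sideFun k₀ g₁) 1)) (G.lab (fib (sideFun k₀ g₂) 1)))
          (joinM (F.lab (fib (sideFun k₀ g₁) 2)) (G.lab (fib (sideFun k₀ g₂) 2))) := by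
  rw [(F.glue G).ZH_eq_sum_fib]
  rw [Fintype.sum_equiv splitEquiv _ (fun p => s6H
      (joinM (F.lab (fib (sideFun p.1 p.2.1) 0)) (G.lab (fib (sideFun p.1 p.2.2) 0)))
      (joinM (F.lab (fib (sideFun p.1 p.2.1) 1)) (G.lab (fib (sideFun p.1 p.2.2) 1)))
      (joinM (F.lab (fib (sideFun p.1 p.2.1) 2)) (G.lab (fib (sideFun p.1 p.2.2) 2))))]
  · rw [Fintype.sum_prod_type, Fintype.sum_congr _ _ fun k₀ => Fintype.sum_prod_type _]
  · intro g
    have hg : g = joinFun (splitEquiv g) := (splitEquiv.left_inv g).symm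
    conv_lhs => rw [hg]
    rw [F.lab_glue, F.lab_glue, F.lab_glue]
    simp only [splitEquiv, Equiv.coe_fn_mk, splitFun, resL_fib_joinFun, resR_fib_joinFun]

end Glue

end Summit.CriticalPhenomena.PercolationContinuityZ3.Theorems.SunflowerPartition
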